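import Summits.QuantumFields.YangMills.Theorems.UnitScaleTiltProp7FrameResponseCombSU2T3
import Literature.MathematicalPhysics.QuantumFieldTheory.Balaban1983to89.B7LocalityGeneral
import Literature.MathematicalPhysics.QuantumFieldTheory.Balaban1983to89.B7Prop7OneStep
import Literature.MathematicalPhysics.QuantumFieldTheory.Balaban1983to89.B8Prop7AdmittedFamily
import Literature.MathematicalPhysics.QuantumFieldTheory.Balaban1983to89.B11Eq98V0LettersFlat
import HarnessLib

/-!
# Route `UnitScaleTilt`, crux K1 «MinimiserStabilityRegPr» (stmt-QuantumFields-19200), route-R E′ (A′)-on-Σ, P-A2-COMB (β), item «F3″-COMB» (★★OWNER RULING №19), file F3a —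
# THE COMB-TOWER ROWS AT A PRINTED-REGULAR BACKGROUND (letters for F3b): per level `j ≤ K − n`, unitarity of `Ū₀ʲ♯, U̿₁ʲ, v_j, Ũ₁ʲ`, the sup rows `‖v_j − 1‖ ≤ 32ε₀`, `‖Ũ₁ʲ − 1‖ ≤ 65ε₀`
# (lit-balaban ✓ `B8Prop7AdmittedFamily` at `RegPr`), the member numerals at `10⁷L⁴ε₀ ≤ 1`, and the LOCAL walk bound for the twisted tree transport on a box

Cell `ym3-torus`, extra width seat `ym-routeR-w6` (gen 8); LOCATE `LOCATE-F3COMB-routeRw6g8.md` (19200 evidence #54); ★★OWNER RULING №19 (05:13Z) O1 + O4.  THEOREMS ONLY (0 `def`,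
0 `sorry`); `--supports stmt-QuantumFields-19200 --as helper`, count-neutral.  YM₃ on T³ is a ladder rung (R3), not the Clay problem; nothing here claims the stub, the crux, (β), `hPA2`,
`hcoS`, d = 4 or the mass gap.

THE POINT.  File F2 (✓ `Prop7CombAccFrameMassStep.combFrameMass_step_le`) displays, per level, bi-contractivity of the background tree transports and of print's comb accumulated frames
`v_l = vcov` ((97)), the frame sup `δ₂`, and the single-bar tree-ratio row of print's comb tower `Ũ₁ˡ = tildIter`.  This file supplies those letters at a printed-regular background
`W ∈ 𝔘_k(ε₀)` for a Hermitian traceless `X` of (19)-size `nMax19 W X < ε₀∕6` — the letters of ✓ `Prop7FrameResponseCombSU2.frameTw_I_smul_mem_specialUnitaryGroup_of_nMax19_lt` VERBATIM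
(`U₀♯ = (W♭)♯`, `B♯ = (iX)♯`, `Lᵏb = ε₀∕6`, `α₀ = 2ε₀`, `αP = 3ε₀`; (1.139) by ✓ `inAk_pull_of_regPr`∕`pdev_pull_lt`, (1.141) by ✓ `pdev_pull_emb15_le_of_regPr_of_nMax19`) — from lit-balaban
✓ `B8Prop7AdmittedFamily` (`avgIter_mem_unitaryUnits`, `avgIter_mul_mem_unitaryUnits`, `dbavgCovIter_vcov_mem_unitaryUnits`, (163) `norm_vcov_sub_one_le`, `norm_tildIter_sub_one_le`), plus the
generic LOCAL walk bound for the twisted tree transport (lit ✓ `B7LocalityGeneral.tHol_treeWord_congr` + ✓ `B7Prop7OneStep.norm_tHol_sub_one_le_general`) which F3b turns into F2's `hR`.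

WHAT IS PROVED (ns `…Theorems.Prop7CombTowerRowsOfRegPr`).
* §1 (generic `ℤᵈ`, complete normed ℂ-algebra) `one_add_pow_sub_one_le_two_mul` (`(1+ε)ⁿ − 1 ≤ 2nε` for `nε ≤ ½`), ★ `norm_tHol_treeWord_sub_one_le_of_box` — a field within `s` of `1` ON THE
  BOX (bi-contractive background) has its twisted tree transport within `2|Γ|s` of `1` (`|Γ|s ≤ ½`).
* §2 (T³, `SU(2)`) `member_windows` (numerals at `10⁷L⁴ε₀ ≤ 1`: `t* = 780L³ε₀ + 96ε₀ ≤ 10⁻⁴`, `390L³ε₀ ≤ ½`, `√(3L³) ≤ 2L²`, `qL ≤ ½` for `q = 3(L⁻³ + 144t*²)`, `3(1+6t*)²(6L)² ≤ 110L²`),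
  ★★ `comb_level_rows_of_regPr` (the six per-level rows above; ONE decl-local `maxHeartbeats 400000` — statement-heavy).
HONEST SCOPE.  Bookkeeping over lit-balaban's certified rows; nothing of print asserted; no summit statement advanced.

References: T. Bałaban, CMP 98 (1985) 17–51 [Balaban1985Averaging] ((52)–(53) p.26, (58)–(60) p.27, (69) p.29, (82) p.30, (85)–(92) p.31, (97) p.32, (159)–(163) p.42, Prop. 7 p.43);
CMP 99 (1985) 75–102 [Balaban1985RegularSpaces] (Prop. 7 (1.139)–(1.145) p.100); CMP 102 (1985) 277–309 [Balaban1985Variational] ((2) p.278, (19) p.281); CMP 109 (1987) 249–301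
[Balaban1987RG1] ((0.3)–(0.4) pp.252–253).
-/

set_option autoImplicit false

noncomputable section

open scoped BigOperators Matrix.Norms.L2Operator

namespace Summit.QuantumFields.YangMills.Theorems.Prop7CombTowerRowsOfRegPr

open Finset NormedSpace
open Literature.MathematicalPhysics.QuantumFieldTheory.Balaban1983to89
open Literature.MathematicalPhysics.QuantumFieldTheory.Balaban1983to89.T3ContinuumYM3Torus
open T4Continuum BlockAveraging
open T3PrintedRegularMinimiser (RegPr)
open T3SectALandauChart (eta eta_pos bgUnits emb15)
open T3LevelShift (siteShift)
open T3PrintedRegularOrbits (sites_eq)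
open B7Prop1Explicit renaming Site → LSite
open B7Prop1Explicit (e hol disp treeWord disp_treeWord boxVec expUnit U1 mem_U1 l1 length_treeWord l1_boxVec_le)
open B7Prop1Local (InBox AgreeOn)
open B7Prop2Explicit (avgIter pdev C0 c2' unitaryUnits unitaryUnits_le_U1 hol_mem_of)
open B7Prop2SpecialUnitary (specialUnitaryUnits mem_specialUnitaryUnits specialUnitaryUnits_le_unitaryUnits)
open B7Prop3Flat (expCfg c3)
open B7Eq92Concrete (Rc Rc_apply tHol tildIter dbavgCovIter vcov vcov_zero)
open B7LocalityGeneral (tHol_treeWord_congr)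
open B7Prop7OneStep (norm_tHol_sub_one_le_general)
open B8Prop7AdmittedFamily (avgIter_mem_unitaryUnits dbavgCovIter_vcov_mem_unitaryUnits norm_vcov_sub_one_le norm_tildIter_sub_one_le)
open B10Eq27TorusAxialLog (pull pull_apply transl unitsField toUField)
open Summit.QuantumFields.YangMills.Theorems.Prop7SPrint (basePt)
open Summit.QuantumFields.YangMills.Theorems.Prop7TPrint (nMax19 nMax19_lt_iff expHermField expHermField_apply coe_expHerm)
open Summit.QuantumFields.YangMills.Theorems.Prop7AxialReprPrint (pull_toUField_mem inAk_pull_of_regPr pdev_pull_lt)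
open Summit.QuantumFields.YangMills.Theorems.Prop7SymAvgGLSmallOfRegPr (bgUnits_eq)
open Summit.QuantumFields.YangMills.Theorems.Prop7SymAvgTw (coordT3 frameTw)
open Summit.QuantumFields.YangMills.Theorems.Prop7SymAvgTwFrameDiff (frameTw_eq_vcov pull_expUnit_eq_expCfg)
open Summit.QuantumFields.YangMills.Theorems.Prop7ChartSigmaT3 (pull_emb15)
open Summit.QuantumFields.YangMills.Theorems.Prop7ChartSigmaT3GlevSU (pull_eq_expCfg_of_exp)
open Summit.QuantumFields.YangMills.Theorems.Prop7ChartSigmaT3OfRegPr (pdev_pull_emb15_le_of_regPr_of_nMax19)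
open Summit.QuantumFields.YangMills.Theorems.Prop7SPrintIn19 (pow_mul_eta)
open Summit.QuantumFields.YangMills.Theorems.Prop7SymFrameBound (coe_expUnit_I_smul_mem_specialUnitaryGroup)
open Summit.QuantumFields.YangMills.Theorems.Prop7FrameResponseCombSU2 (windows_of_ten7 tower_windows_of_ten7)
open B11Eq98V0LettersFlat (norm_inv_sub_one_le)

/-! ## §1 Generic `ℤᵈ`: the tree transport of a field within `s` of `1` on the box is within `2|Γ|s` of `1` -/

section Generic

variable {d : ℕ} {𝔸 : Type*} [NormedRing 𝔸] [NormedAlgebra ℂ 𝔸] [CompleteSpace 𝔸]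

omit [NormedAlgebra ℂ 𝔸] [CompleteSpace 𝔸] in
/-- `(1 + ε)ⁿ − 1 ≤ 2nε` for `0 ≤ ε`, `nε ≤ ½` (`1 + ε ≤ e^ε`, `eˣ − 1 ≤ x + x² ≤ 2x` on `[0, ½]`). [folklore] -/
theorem one_add_pow_sub_one_le_two_mul {ε : ℝ} (hε : 0 ≤ ε) (n : ℕ) (hn : (n : ℝ) * ε ≤ 1 / 2) : (1 + ε) ^ n - 1 ≤ 2 * ((n : ℝ) * ε) := by
  have h1 : (1 + ε) ^ n ≤ Real.exp ((n : ℝ) * ε) := by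
    rw [Real.exp_nat_mul]
    exact pow_le_pow_left₀ (by positivity) (by linarith [Real.add_one_le_exp ε]) n
  have hx0 : 0 ≤ (n : ℝ) * ε := by positivity
  have h2 := Real.abs_exp_sub_one_sub_id_le (x := (n : ℝ) * ε) (by rw [abs_of_nonneg hx0]; linarith)
  have h3 := (abs_le.1 h2).2
  nlinarith [sq_nonneg ((n : ℝ) * ε)]

omit [NormedAlgebra ℂ 𝔸] [CompleteSpace 𝔸] in
/-- ★ **LOCAL WALK BOUND FOR THE TWISTED TREE TRANSPORT**: for a bi-contractive background `V₀` and a field `V₁` whose bond variables WITH BOTH END POINTS IN THE BOX `[lo, hi]` (and their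
inverses) are within `s` of `1`, the twisted transport (58) along the tree contour `Γ_{p, p+v}` inside the box satisfies `‖(R_{0,p}V₁)(Γ_{p,p+v}) − 1‖ ≤ 2·|Γ|·s` once `|Γ|·s ≤ ½`
(`|Γ| = l¹(v)`): LOCALITY (lit ✓ `tHol_treeWord_congr`: replace `V₁` by `1` off the box) + the uniform walk bound (lit ✓ `norm_tHol_sub_one_le_general` at `M = 1`) + §1's numeral.
[cite: Balaban1985Averaging, (58)-(60) p.27, p.24 (tree contours), Prop. 7 p.43] -/
theorem norm_tHol_treeWord_sub_one_le_of_box (V₀ V₁ : LSite d → Fin d → 𝔸ˣ)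
    (hV₀ : ∀ x κ, ‖((V₀ x κ : 𝔸ˣ) : 𝔸)‖ ≤ 1 ∧ ‖(((V₀ x κ)⁻¹ : 𝔸ˣ) : 𝔸)‖ ≤ 1)
    {lo hi : LSite d} {s : ℝ} (hs : 0 ≤ s)
    (hV₁ : ∀ x κ, InBox lo hi x → InBox lo hi (x + e κ) → ‖((V₁ x κ : 𝔸ˣ) : 𝔸) - 1‖ ≤ s ∧ ‖(((V₁ x κ)⁻¹ : 𝔸ˣ) : 𝔸) - 1‖ ≤ s)
    (p v : LSite d) (hp : InBox lo hi p) (hpv : InBox lo hi (p + v)) (hn : ((treeWord v).length : ℝ) * s ≤ 1 / 2) :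
    ‖((tHol V₀ V₁ p (treeWord v) : 𝔸ˣ) : 𝔸) - 1‖ ≤ 2 * (((treeWord v).length : ℝ) * s) := by
  classical
  -- the field localised to the box
  set V₁' : LSite d → Fin d → 𝔸ˣ := fun x κ => if InBox lo hi x ∧ InBox lo hi (x + e κ) then V₁ x κ else 1 with hV₁'
  have hagree : AgreeOn lo hi V₁ V₁' := by
    intro x κ hx hxe
    rw [hV₁']; dsimp only; rw [if_pos ⟨hx, hxe⟩]
  have hagree₀ : AgreeOn lo hi V₀ V₀ := fun _ _ _ _ => rfl
  rw [tHol_treeWord_congr hagree₀ hagree p v hp hpv]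
  -- the uniform rows for the localised field
  have hV' : ∀ x κ, ‖((V₁' x κ : 𝔸ˣ) : 𝔸) - 1‖ ≤ s ∧ ‖(((V₁' x κ)⁻¹ : 𝔸ˣ) : 𝔸) - 1‖ ≤ s := by
    intro x κ
    rw [hV₁']; dsimp only
    by_cases hb : InBox lo hi x ∧ InBox lo hi (x + e κ)
    · rw [if_pos hb]; exact hV₁ x κ hb.1 hb.2
    · rw [if_neg hb]; simp [hs]
  have hW : ∀ x κ, ‖((V₀ x κ : 𝔸ˣ) : 𝔸)‖ ≤ (1 : ℝ) ∧ ‖(((V₀ x κ)⁻¹ : 𝔸ˣ) : 𝔸)‖ ≤ (1 : ℝ) := hV₀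
  have h := norm_tHol_sub_one_le_general (le_refl (1 : ℝ)) hs hW hV' (treeWord v) p
  rw [one_pow, one_mul] at h
  exact h.trans (one_add_pow_sub_one_le_two_mul hs _ hn)

end Generic

/-! ## §2 Member letters: windows at `10⁷L³ε₀ ≤ 1`; the per-level unitarity and sup rows of the comb towers from lit-balaban -/

section Member

variable (F : T3Family) {n K : ℕ} (h : n ≤ K)

/-- the member numerals at `10⁷L⁴ε₀ ≤ 1` (`L ≥ 3`): `t* := 780L³ε₀ + 96ε₀ ≤ 10⁻⁴`, `3L·(2L²·65ε₀) ≤ ½`, `√(3L³) ≤ 2L²`, `qL ≤ ½` for `q = 3(L⁻³ + 144t*²)`, and `3(1+6t*)²(6L)² ≤ 110L²`.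
[folklore] -/
theorem member_windows {ε₀ : ℝ} (hε₀ : 0 ≤ ε₀) (hε : 10 ^ 7 * (F.L : ℝ) ^ 4 * ε₀ ≤ 1) :
    780 * (F.L : ℝ) ^ 3 * ε₀ + 3 * (32 * ε₀) ≤ 1 / 10 ^ 4 ∧
      3 * (F.L : ℝ) * (2 * (F.L : ℝ) ^ 2 * (65 * ε₀)) ≤ 1 / 2 ∧
      Real.sqrt (3 * (F.L : ℝ) ^ 3) ≤ 2 * (F.L : ℝ) ^ 2 ∧
      3 * (((F.L : ℝ) ^ 3)⁻¹ + 144 * (780 * (F.L : ℝ) ^ 3 * ε₀ + 3 * (32 * ε₀)) ^ 2) * (F.L : ℝ) ≤ 1 / 2 ∧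
      3 * (1 + 6 * (780 * (F.L : ℝ) ^ 3 * ε₀ + 3 * (32 * ε₀))) ^ 2 * (6 * (F.L : ℝ)) ^ 2 ≤ 110 * (F.L : ℝ) ^ 2 := by
  have hL3 : (3 : ℝ) ≤ F.L := by
    have h3 : 3 ≤ F.L := by obtain ⟨a, ha⟩ := F.hL.1; have := F.hL.2; omega
    exact_mod_cast h3
  have hL0 : (0 : ℝ) < F.L := by linarith
  have hL1 : (1 : ℝ) ≤ F.L := by linarith
  have hL27 : (27 : ℝ) ≤ (F.L : ℝ) ^ 3 := by
    have h := pow_le_pow_left₀ (by norm_num : (0 : ℝ) ≤ 3) hL3 3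
    norm_num at h
    exact h
  -- the two products `u := L³ε₀`, `w := L⁴ε₀`
  set u : ℝ := (F.L : ℝ) ^ 3 * ε₀ with hu
  set w : ℝ := (F.L : ℝ) ^ 4 * ε₀ with hw
  have hu0 : 0 ≤ u := by positivity
  have hw7 : w ≤ 1 / 10 ^ 7 := by rw [hw]; linarith
  have huw : u ≤ w := by
    rw [hu, hw]
    have : (F.L : ℝ) ^ 3 ≤ (F.L : ℝ) ^ 4 := pow_le_pow_right₀ hL1 (by norm_num)
    exact mul_le_mul_of_nonneg_right this hε₀
  have hu7 : u ≤ 1 / 10 ^ 7 := huw.trans hw7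
  have hε7 : ε₀ ≤ u := by rw [hu]; nlinarith
  set t : ℝ := 780 * (F.L : ℝ) ^ 3 * ε₀ + 3 * (32 * ε₀) with ht
  have ht0 : 0 ≤ t := by positivity
  have htu : t ≤ 876 * u := by rw [ht, hu]; nlinarith
  have ht4 : t ≤ 1 / 10 ^ 4 := by linarith
  -- `L·t² ≤ 876²·u·w`
  have hLt2 : (F.L : ℝ) * t ^ 2 ≤ 876 ^ 2 * (u * w) := by
    have h1 : (F.L : ℝ) * t ^ 2 ≤ (F.L : ℝ) * (876 * u) ^ 2 := mul_le_mul_of_nonneg_left (pow_le_pow_left₀ ht0 htu 2) hL0.le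
    have h2 : (F.L : ℝ) * (876 * u) ^ 2 = 876 ^ 2 * (u * ((F.L : ℝ) * u)) := by ring
    have h3 : (F.L : ℝ) * u = w := by rw [hu, hw]; ring
    rw [h2, h3] at h1
    exact h1
  have huw14 : u * w ≤ 1 / 10 ^ 14 := by
    calc u * w ≤ (1 / 10 ^ 7) * (1 / 10 ^ 7) := mul_le_mul hu7 hw7 (by rw [hw]; positivity) (by norm_num)
      _ = 1 / 10 ^ 14 := by norm_num
  refine ⟨ht4, ?_, ?_, ?_, ?_⟩
  · calc 3 * (F.L : ℝ) * (2 * (F.L : ℝ) ^ 2 * (65 * ε₀)) = 390 * u := by rw [hu]; ring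
      _ ≤ 1 / 2 := by linarith
  · rw [Real.sqrt_le_left (by positivity)]
    nlinarith [pow_pos hL0 3, pow_pos hL0 4]
  · have h1 : 3 * ((F.L : ℝ) ^ 3)⁻¹ * (F.L : ℝ) = 3 / (F.L : ℝ) ^ 2 := by field_simp
    have h2 : 3 / (F.L : ℝ) ^ 2 ≤ 1 / 3 := by rw [div_le_iff₀ (by positivity)]; nlinarith
    have h3 : 3 * (144 * t ^ 2) * (F.L : ℝ) ≤ 1 / 6 := by
      calc 3 * (144 * t ^ 2) * (F.L : ℝ) = 432 * ((F.L : ℝ) * t ^ 2) := by ring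
        _ ≤ 432 * (876 ^ 2 * (u * w)) := by linarith [hLt2]
        _ ≤ 1 / 6 := by nlinarith [huw14]
    calc 3 * (((F.L : ℝ) ^ 3)⁻¹ + 144 * t ^ 2) * (F.L : ℝ) = 3 * ((F.L : ℝ) ^ 3)⁻¹ * (F.L : ℝ) + 3 * (144 * t ^ 2) * (F.L : ℝ) := by ring
      _ ≤ 1 / 3 + 1 / 6 := by rw [h1]; exact add_le_add h2 h3
      _ = 1 / 2 := by norm_num
  · have h1 : (1 + 6 * t) ^ 2 ≤ 101 / 100 := by nlinarith
    have hL2 : 0 ≤ (F.L : ℝ) ^ 2 := by positivity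
    calc 3 * (1 + 6 * t) ^ 2 * (6 * (F.L : ℝ)) ^ 2 = 108 * (1 + 6 * t) ^ 2 * (F.L : ℝ) ^ 2 := by ring
      _ ≤ 108 * (101 / 100) * (F.L : ℝ) ^ 2 := by nlinarith
      _ ≤ 110 * (F.L : ℝ) ^ 2 := by nlinarith

set_option maxHeartbeats 400000 in
/-- **THE COMB TOWER ROWS AT A PRINTED-REGULAR BACKGROUND, PER LEVEL `j ≤ k = K − n`** (lit-balaban ✓ `B8Prop7AdmittedFamily` at the letters of ✓ `frameTw_I_smul_mem_specialUnitaryGroup_of_nMax19_lt`: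
`U₀♯ = (W♭)♯`, `B♯ = (iX)♯`, `Lᵏb = ε₀∕6`, `α₀ = 2ε₀`, `αP = 3ε₀`): the averaged backgrounds `Ū₀ʲ♯`, the double-bar tower `U̿₁ʲ` and the frames `v_j` are unitary; `‖v_j(z) − 1‖, ‖v_j(z)⁻¹ − 1‖ ≤ 32ε₀`
((163)); and the single-bar comb tower is within `65ε₀` of `1`: `‖Ũ₁ʲ(b) − 1‖ ≤ 65ε₀` (`130dLʲb`).
[cite: Balaban1985Averaging, (159)-(163) p.42, (52)-(53) p.26; Balaban1985RegularSpaces, Prop. 7 (1.139)-(1.141) p.100; Balaban1985Variational, (19) p.281] -/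
theorem comb_level_rows_of_regPr {ε₀ : ℝ} (hε₀ : 0 < ε₀) (hε : 10 ^ 7 * (F.L : ℝ) ^ 3 * ε₀ ≤ 1)
    (W : GaugeField (F.P K) 0 (Matrix.specialUnitaryGroup (Fin 2) ℂ)) (hreg : RegPr F n K ε₀ W)
    (X : PBond (F.P K) 0 → Matrix (Fin 2) (Fin 2) ℂ) (hX : ∀ b, (X b).IsHermitian ∧ (X b).trace = 0) (hX6 : nMax19 F n K W X < ε₀ / 6) :
    ∀ j ≤ K - n,
      (∀ (z : LSite (F.P K).d) (κ : Fin (F.P K).d),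
          letI : CStarAlgebra (Matrix (Fin 2) (Fin 2) ℂ) := B10Eq29TubeLine.cstarAlgebraMatrix 2
          avgIter (F.P K).L (pull (bgUnits F K W) (basePt F n K)) j z κ ∈ unitaryUnits (Matrix (Fin 2) (Fin 2) ℂ)) ∧
      (∀ (z : LSite (F.P K).d) (κ : Fin (F.P K).d),
          letI : CStarAlgebra (Matrix (Fin 2) (Fin 2) ℂ) := B10Eq29TubeLine.cstarAlgebraMatrix 2
          dbavgCovIter (F.P K).L (pull (bgUnits F K W) (basePt F n K)) (expCfg fun z κ => Complex.I • X ⟨transl (basePt F n K) z, κ⟩) j z κ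
            ∈ unitaryUnits (Matrix (Fin 2) (Fin 2) ℂ)) ∧
      (∀ z : LSite (F.P K).d,
          letI : CStarAlgebra (Matrix (Fin 2) (Fin 2) ℂ) := B10Eq29TubeLine.cstarAlgebraMatrix 2
          vcov (F.P K).L (pull (bgUnits F K W) (basePt F n K)) (expCfg fun z κ => Complex.I • X ⟨transl (basePt F n K) z, κ⟩) j z ∈ unitaryUnits (Matrix (Fin 2) (Fin 2) ℂ)) ∧
      (∀ z : LSite (F.P K).d,
          ‖((vcov (F.P K).L (pull (bgUnits F K W) (basePt F n K)) (expCfg fun z κ => Complex.I • X ⟨transl (basePt F n K) z, κ⟩) j z : (Matrix (Fin 2) (Fin 2) ℂ)ˣ) :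
              Matrix (Fin 2) (Fin 2) ℂ) - 1‖ ≤ 32 * ε₀ ∧
            ‖(((vcov (F.P K).L (pull (bgUnits F K W) (basePt F n K)) (expCfg fun z κ => Complex.I • X ⟨transl (basePt F n K) z, κ⟩) j z)⁻¹ : (Matrix (Fin 2) (Fin 2) ℂ)ˣ) :
              Matrix (Fin 2) (Fin 2) ℂ) - 1‖ ≤ 32 * ε₀) ∧
      (∀ (z : LSite (F.P K).d) (κ : Fin (F.P K).d),
          ‖((tildIter (F.P K).L (pull (bgUnits F K W) (basePt F n K)) (expCfg fun z κ => Complex.I • X ⟨transl (basePt F n K) z, κ⟩) j z κ : (Matrix (Fin 2) (Fin 2) ℂ)ˣ) :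
              Matrix (Fin 2) (Fin 2) ℂ) - 1‖ ≤ 65 * ε₀) ∧
      (∀ (z : LSite (F.P K).d) (κ : Fin (F.P K).d),
          letI : CStarAlgebra (Matrix (Fin 2) (Fin 2) ℂ) := B10Eq29TubeLine.cstarAlgebraMatrix 2
          tildIter (F.P K).L (pull (bgUnits F K W) (basePt F n K)) (expCfg fun z κ => Complex.I • X ⟨transl (basePt F n K) z, κ⟩) j z κ ∈ unitaryUnits (Matrix (Fin 2) (Fin 2) ℂ)) := by
  letI : CStarAlgebra (Matrix (Fin 2) (Fin 2) ℂ) := B10Eq29TubeLine.cstarAlgebraMatrix 2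
  have hL2 : 2 ≤ (F.P K).L := (F.P K).hL.2
  have hd3 : (F.P K).d = 3 := T3Family.P_d F K
  have hd3r : ((F.P K).d : ℝ) = 3 := by exact_mod_cast hd3
  have hd1 : 1 ≤ (F.P K).d := by rw [hd3]; norm_num
  have hη : 0 < eta F n K := eta_pos F n K
  have hLη : ((F.P K).L : ℝ) ^ (K - n) * eta F n K = 1 := pow_mul_eta F n K
  set x₀ := basePt F n K with hx₀
  set B : LSite (F.P K).d → Fin (F.P K).d → Matrix (Fin 2) (Fin 2) ℂ := fun z κ => Complex.I • X ⟨transl x₀ z, κ⟩ with hB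
  set b : ℝ := ε₀ / 6 * eta F n K with hb
  have hb0 : 0 ≤ b := by positivity
  have hLb : ((F.P K).L : ℝ) ^ (K - n) * b = ε₀ / 6 := by rw [hb, mul_left_comm, hLη, mul_one]
  obtain ⟨h19, -, -, -⟩ := nMax19_lt_iff.1 hX6
  have hBb : ∀ z κ, ‖B z κ‖ ≤ b := fun z κ => by
    rw [hB]; dsimp only
    rw [norm_smul, Complex.norm_I, one_mul]
    exact (h19 _).le
  -- unitarity of the data
  have hU₀s : ∀ z κ, pull (bgUnits F K W) x₀ z κ ∈ specialUnitaryUnits (Fin 2) := fun z κ => by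
    rw [bgUnits_eq]; exact pull_toUField_mem W _ z κ
  have hU₀ : ∀ z κ, pull (bgUnits F K W) x₀ z κ ∈ unitaryUnits (Matrix (Fin 2) (Fin 2) ℂ) := fun z κ => specialUnitaryUnits_le_unitaryUnits (hU₀s z κ)
  have hBu : ∀ z κ, expCfg B z κ ∈ unitaryUnits (Matrix (Fin 2) (Fin 2) ℂ) := fun z κ => by
    refine specialUnitaryUnits_le_unitaryUnits ?_
    rw [mem_specialUnitaryUnits]
    show ((expUnit (Complex.I • X ⟨transl x₀ z, κ⟩) : (Matrix (Fin 2) (Fin 2) ℂ)ˣ) : Matrix (Fin 2) (Fin 2) ℂ) ∈ Matrix.specialUnitaryGroup (Fin 2) ℂ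
    exact coe_expUnit_I_smul_mem_specialUnitaryGroup (hX _).1 (hX _).2
  -- windows
  obtain ⟨hα3, hα4, -, hαP3, hαP2⟩ := windows_of_ten7 F (K := K) hε₀.le hε
  obtain ⟨hsmall, hc₃, hsm⟩ := tower_windows_of_ten7 F (K := K) hε₀.le hε
  rw [← hLb] at hsmall hc₃ hsm
  -- (1.139) and (1.141) on the based pullbacks
  have h52 : pdev (pull (bgUnits F K W) x₀) < 2 * ε₀ * ((((F.P K).L : ℝ) ^ (K - n))⁻¹) ^ 2 := by
    rw [bgUnits_eq]; exact pdev_pull_lt (P := F.P K) hε₀ (inAk_pull_of_regPr F (n := n) (K := K) hε₀.le hreg) x₀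
  have hP : pdev (expCfg B * pull (bgUnits F K W) x₀) < 3 * ε₀ * ((((F.P K).L : ℝ) ^ (K - n))⁻¹) ^ 2 := by
    have hU₁ : ∀ b' : PBond (F.P K) 0, ((expHermField X b' : Matrix.specialUnitaryGroup (Fin 2) ℂ) : Matrix (Fin 2) (Fin 2) ℂ) = exp (Complex.I • X b') :=
      fun b' => by rw [expHermField_apply, coe_expHerm (hX b')]
    have hL1 : (1 : ℝ) ≤ (F.L : ℝ) ^ 3 := one_le_pow₀ (by exact_mod_cast F.hL.2.le)
    have hε8 : 2 * ε₀ ≤ 1 / 8 := by nlinarith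
    have he20 : ε₀ / 6 ≤ 1 / 20 := by nlinarith
    have hle := pdev_pull_emb15_le_of_regPr_of_nMax19 F hε₀ (by positivity : (0 : ℝ) ≤ ε₀ / 6) hε8 he20 W (expHermField X) hreg X
      (fun b' => (hX b').1) hU₁ hX6
    rw [pull_emb15, pull_eq_expCfg_of_exp F (expHermField X) X hU₁ x₀, ← bgUnits_eq] at hle
    have hpos : 0 < ε₀ * ((((F.P K).L : ℝ) ^ (K - n))⁻¹) ^ 2 := by
      have : 0 < (((F.P K).L : ℝ) ^ (K - n))⁻¹ := inv_pos.2 (pow_pos (by exact_mod_cast (F.P K).L_pos) _)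
      positivity
    exact lt_of_le_of_lt hle (by nlinarith)
  have hα : (0 : ℝ) < 2 * ε₀ := by positivity
  have hαP : (0 : ℝ) < 3 * ε₀ := by positivity
  -- level arithmetic: `64·3·Lʲb ≤ 32ε₀`, `130·3·Lʲb ≤ 65ε₀` for `j ≤ k`
  have hLjb : ∀ j ≤ K - n, ((F.P K).L : ℝ) ^ j * b ≤ ε₀ / 6 := by
    intro j hj
    rw [← hLb]
    exact mul_le_mul_of_nonneg_right (pow_le_pow_right₀ (by exact_mod_cast (F.P K).L_pos) hj) hb0
  intro j hj
  obtain ⟨hWu, hvu⟩ := dbavgCovIter_vcov_mem_unitaryUnits hd1 hL2 hU₀ hBu hα hα3 hα4 h52 hb0 hBb hsmall hc₃ hsm hαP hαP3 hαP2 hP j hj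
  refine ⟨fun z κ => avgIter_mem_unitaryUnits hL2 hU₀ hα hα3 hα4 h52 j hj z κ, hWu, hvu, fun z => ?_, fun z κ => ?_, fun z κ => ?_⟩
  · obtain ⟨h1, h2⟩ := norm_vcov_sub_one_le hL2 hU₀ hα hα3 hα4 h52 hb0 hBb hsmall hc₃ hsm hj z
    have hx := hLjb j hj
    rw [hd3r] at h1 h2
    exact ⟨h1.trans (by nlinarith), h2.trans (by nlinarith)⟩
  · have h1 := norm_tildIter_sub_one_le hd1 hL2 hU₀ hBu hα hα3 hα4 h52 hb0 hBb hsmall hc₃ hsm hαP hαP3 hαP2 hP hj z κ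
    have hx := hLjb j hj
    rw [hd3r] at h1
    exact h1.trans (by nlinarith)
  · rw [B7Eq92Concrete.tildIter_apply]
    exact (unitaryUnits _).mul_mem (B8Prop7AdmittedFamily.avgIter_mul_mem_unitaryUnits hL2 hU₀ hBu hαP hαP3 hαP2 hP j hj z κ)
      ((unitaryUnits _).inv_mem (avgIter_mem_unitaryUnits hL2 hU₀ hα hα3 hα4 h52 j hj z κ))

end Member

end Summit.QuantumFields.YangMills.Theorems.Prop7CombTowerRowsOfRegPr

end
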